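import Summits.Ventures.QEC.Census.BB.BB288.CoverAutsA
import Summits.Ventures.QEC.Census.BB.BB288.CoverAutsB
import Summits.Ventures.QEC.Census.BB.BB288.CoverAutsC
import Summits.Ventures.QEC.Census.BB.BB288.CoverAutsD
import Summits.Ventures.QEC.Census.BB.BB288.CoverAutsE
import Summits.Ventures.QEC.Census.BB.BB288.CoverAutsF
import HarnessLib

set_option Elab.async false

/-!
# `[[288,12,18]]` cover certificate — DATA 2g: the automorphism tables as lists (index `6a+b`).
-/

namespace Summit.Ventures.QEC.Census.BB288Cover

open Summit.Ventures.QEC.Census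

/-- The 72 qubit permutations upstairs. -/
def perms : List (List ℕ) := [perm0, perm1, perm2, perm3, perm4, perm5, perm6, perm7, perm8, perm9, perm10, perm11, perm12, perm13, perm14, perm15, perm16, perm17, perm18, perm19, perm20, perm21, perm22, perm23, perm24, perm25, perm26, perm27, perm28, perm29, perm30, perm31, perm32, perm33, perm34, perm35, perm36, perm37, perm38, perm39, perm40, perm41, perm42, perm43, perm44, perm45, perm46, perm47, perm48, perm49, perm50, perm51, perm52, perm53, perm54, perm55, perm56, perm57, perm58, perm59, perm60, perm61, perm62, perm63, perm64, perm65, perm66, perm67, perm68, perm69, perm70, perm71]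

/-- Their row maps. -/
def rowss : List (List ℕ) := [rows0, rows1, rows2, rows3, rows4, rows5, rows6, rows7, rows8, rows9, rows10, rows11, rows12, rows13, rows14, rows15, rows16, rows17, rows18, rows19, rows20, rows21, rows22, rows23, rows24, rows25, rows26, rows27, rows28, rows29, rows30, rows31, rows32, rows33, rows34, rows35, rows36, rows37, rows38, rows39, rows40, rows41, rows42, rows43, rows44, rows45, rows46, rows47, rows48, rows49, rows50, rows51, rows52, rows53, rows54, rows55, rows56, rows57, rows58, rows59, rows60, rows61, rows62, rows63, rows64, rows65, rows66, rows67, rows68, rows69, rows70, rows71]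

/-- Their shadows on 144 qubits. -/
def permqs : List (List ℕ) := [permq0, permq1, permq2, permq3, permq4, permq5, permq6, permq7, permq8, permq9, permq10, permq11, permq12, permq13, permq14, permq15, permq16, permq17, permq18, permq19, permq20, permq21, permq22, permq23, permq24, permq25, permq26, permq27, permq28, permq29, permq30, permq31, permq32, permq33, permq34, permq35, permq36, permq37, permq38, permq39, permq40, permq41, permq42, permq43, permq44, permq45, permq46, permq47, permq48, permq49, permq50, permq51, permq52, permq53, permq54, permq55, permq56, permq57, permq58, permq59, permq60, permq61, permq62, permq63, permq64, permq65, permq66, permq67, permq68, permq69, permq70, permq71]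

/-- Their shadows on 72 qubits. -/
def permqqs : List (List ℕ) := [permqq0, permqq1, permqq2, permqq3, permqq4, permqq5, permqq6, permqq7, permqq8, permqq9, permqq10, permqq11, permqq12, permqq13, permqq14, permqq15, permqq16, permqq17, permqq18, permqq19, permqq20, permqq21, permqq22, permqq23, permqq24, permqq25, permqq26, permqq27, permqq28, permqq29, permqq30, permqq31, permqq32, permqq33, permqq34, permqq35, permqq36, permqq37, permqq38, permqq39, permqq40, permqq41, permqq42, permqq43, permqq44, permqq45, permqq46, permqq47, permqq48, permqq49, permqq50, permqq51, permqq52, permqq53, permqq54, permqq55, permqq56, permqq57, permqq58, permqq59, permqq60, permqq61, permqq62, permqq63, permqq64, permqq65, permqq66, permqq67, permqq68, permqq69, permqq70, permqq71]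

end Summit.Ventures.QEC.Census.BB288Cover
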